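import Summits.HodgeConjecture.HodgeConjecture.Theorems.MarkmanPartnerTransportPicardThreeK3SquaresAnnihilatingPolynomial
import Summits.HodgeConjecture.HodgeConjecture.Theorems.MarkmanPartnerTransportPicardThreeK3SquaresOneCycleAlgebra
import Summits.HodgeConjecture.HodgeConjecture.Theorems.MarkmanPartnerTransportLowPicardRMCellGenPrime

/-!
# Route MarkmanPartnerTransport · crux `PicardThreeK3Squares` (stmt-HodgeConjecture-19652) —
# ONE CYCLE SUFFICES in a KNOWN real-multiplication type («K3-CELL-GEN», the K3-side twin of «CELL-GEN»)

Cell hodge-nonav, chapter ROUTE-P1AL (RM cells); prover seat hodge-nonav-20241-p1 (gen 16), self-pick = the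
K3-side twin of the `X`-side «CELL-GEN» (`…LowPicardRMCellGen`, `…LowPicardRMCellGenPrime`). Route-independent
(no Theses import); `--supports stmt-HodgeConjecture-19652` helper.

The K3-side «ONE CYCLE SUFFICES» lemmas decide whether ONE rational Hodge endomorphism `t` of `H²(S(ℂ); ℂ)`
generates `End_Hdg(T(S))` from the DEGREE `k` of its `(2,0)`-eigenvalue ALONE, under the arithmetic law
`k·j·m + ρ(S) ≠ 22` (`…OneCycleDegree`) or `[E:ℚ]` prime (`…OneCycle`), or at odd Picard number. When the
real-multiplication TYPE of `S` is KNOWN — some rational Hodge endomorphism `θ` already generates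
`End_Hdg(T(S)) = ℚ[θ|_T]` and its `(2,0)`-eigenvalue has degree `d` (so `[E:ℚ] = d`) — no arithmetic is needed:

* `apply_eq_zero_of_transc_of_apply_twoZero_eq_zero` — a rational, type-preserving endomorphism of `H²(S)`
  KILLING the `(2,0)`-class vanishes on `T(S)` (Zarhin: `E(S)` is a field; here from
  `exists_annihilating_polynomial`: `P(f) σ = P(0) σ ≠ 0`);
* `isIntegral_eigenvalue_twoZero` — the `(2,0)`-eigenvalue of a rational, type-preserving endomorphism is
  algebraic over `ℚ`;
* **`transcendentalEndomorphismsGeneratedBy_of_generatedBy_of_natDegree`** («K3-CELL-GEN»): `θ` rational,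
  type-preserving, GENERATING (`TranscendentalEndomorphismsGeneratedBy S θ`) with `(2,0)`-eigenvalue of degree
  `d`; `t` rational, type-preserving, killing `N¹(S)`, image cup-orthogonal to `N¹(S)`, with `(2,0)`-eigenvalue
  of degree `d` ⟹ `TranscendentalEndomorphismsGeneratedBy S t`. Proof (as on the `X` side): `t = P(θ)` on `T`
  (generation) ⟹ `ev_t = P(ev_θ)`; equal degrees ⟹ `ℚ(ev_t) = ℚ(ev_θ)`, `ev_θ = Q(ev_t)`; `Q(t) − θ` kills `σ`,
  hence vanishes on `T`; so `ℚ[θ|_T] ⊆ ℚ[t|_T]`;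
* **`transcendentalEndomorphismsGeneratedBy_of_generatedBy_of_irrational_of_prime`** — `d` PRIME: any
  IRRATIONAL `(2,0)`-eigenvalue of `t` suffices (`natDegree_minpoly_eq_of_prime_of_irrational`).

Where it bites beyond `…OneCycleDegree`: the types with `22 − ρ(S) = d·j·m` (`j ≥ 2`, `m ≥ 3`), e.g.
`(ρ(S), d) ∈ {(2,2), (4,2), (4,3), (6,2), (6,4), (10,2), (10,3)}` — van Geemen–Schütt's `ℚ(√2)`-family at
`ρ = 10` (Thm. 1.2 (2)) and the quadratic cell `(3,2)` of crux #5 on the K3 side (`ρ(S) = 2`, `20 = 2·2·5`).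
CONDITIONAL only on the marking fact `Huybrechts_K3_marking_exists` (displayed); no definition, no sorry, no new
named fact; credits nothing to HC (the open content of every RM cell is the EXISTENCE of the cycle).

References: Yu. G. Zarhin, J. reine angew. Math. 341 (1983) Thm. 1.5.1, Thm. 1.6; D. Huybrechts, *Lectures on K3
Surfaces*, Ch. 3 Lemma 3.3.1, Cor. 3.3.6; B. van Geemen, Michigan Math. J. 56 (2008) Lemma 3.2; B. van Geemen,
M. Schütt, Forum Math. Sigma 13 (2025) e2, §2.1, §4.8, Thm. 1.2 (2).
-/

set_option linter.dupNamespace false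

noncomputable section

namespace Summit.HodgeConjecture.HodgeConjecture.Theorems.MarkmanPartnerTransport.OneCycle

open Module CategoryTheory MonoidalCategory Polynomial
open Literature.AlgebraicGeometry Literature.AlgebraicGeometry.Motives Literature.AlgebraicGeometry.HodgeTheory
open Literature.AlgebraicGeometry.Surfaces
open Literature.AlgebraicTopology.SingularHomology
open Summit.HodgeConjecture.HodgeConjecture.Theorems
open Summit.HodgeConjecture.HodgeConjecture.Theorems.MarkmanPartnerTransport.KugaSatakeSimilitude
  (exists_annihilating_polynomial)
open Summit.HodgeConjecture.HodgeConjecture.Theorems.MarkmanPartnerTransport.PartnerLattice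
  (exists_aeval_eq_of_natDegree_minpoly_eq natDegree_minpoly_eq_of_prime_of_irrational pow_apply_eq_of_eqOn
    aeval_apply_eq_of_eqOn exists_fin_sum_eq_aeval_ratPoly)

variable {S : SchemeOver ℂ}

/-- `Transc[S, y]`: `y` is cup-orthogonal to `N¹(S)`. Local notation only. -/
local notation3 (prettyPrint := false) "Transc[" S ", " y "]" =>
  (∀ d ∈ algebraicClasses S 1, cupProduct (rfl : 2 * 1 + 2 * 1 = 2 * 2) y d = 0)

/-! ### §0 Helpers: powers and rational polynomials of an endomorphism of `H²(S(ℂ); ℂ)` -/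

/-- Powers of an endomorphism act on an eigenvector by powers of the eigenvalue. [folklore] -/
theorem pow_apply_of_apply_eq_smul (f : complexBetti S (2 * 1) →ₗ[ℂ] complexBetti S (2 * 1))
    {σ : complexBetti S (2 * 1)} {ev : ℂ} (h : f σ = ev • σ) : ∀ k : ℕ, (f ^ k) σ = ev ^ k • σ := by
  intro k
  induction k with
  | zero => rw [pow_zero, pow_zero, Module.End.one_apply, one_smul]
  | succ k ih => rw [pow_succ', Module.End.mul_apply, ih, map_smul, h, smul_smul, pow_succ]

/-- **A rational polynomial in `f`, evaluated** — `(p.map (ℚ → ℂ))(f)`: rational classes go to rational classes,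
Hodge types are preserved, and an eigenvector `σ` of `f` with eigenvalue `ev` is an eigenvector with eigenvalue
`p(ev)`. [folklore] -/
theorem aeval_ratPoly_apply_surface (hS : IsSmoothProjective 2 S)
    (f : complexBetti S (2 * 1) →ₗ[ℂ] complexBetti S (2 * 1))
    (h1 : ∀ y, IsRationalClass y → IsRationalClass (f y))
    (h2 : ∀ (i j : ℕ) y, IsOfHodgeType 2 S (2 * 1) i j y → IsOfHodgeType 2 S (2 * 1) i j (f y))
    {σ : complexBetti S (2 * 1)} {ev : ℂ} (hσ : f σ = ev • σ) (p : ℚ[X]) :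
    (∀ y, IsRationalClass y → IsRationalClass (aeval f (p.map (algebraMap ℚ ℂ)) y)) ∧
    (∀ (i j : ℕ) y, IsOfHodgeType 2 S (2 * 1) i j y →
      IsOfHodgeType 2 S (2 * 1) i j (aeval f (p.map (algebraMap ℚ ℂ)) y)) ∧
    aeval f (p.map (algebraMap ℚ ℂ)) σ = (aeval ev p) • σ := by
  induction p using Polynomial.induction_on' with
  | add p q hp hq =>
    obtain ⟨hp1, hp2, hp3⟩ := hp
    obtain ⟨hq1, hq2, hq3⟩ := hq
    refine ⟨fun y hy => ?_, fun i j y hy => ?_, ?_⟩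
    · rw [Polynomial.map_add, map_add, LinearMap.add_apply]
      exact (hp1 y hy).add (hq1 y hy)
    · rw [Polynomial.map_add, map_add, LinearMap.add_apply]
      exact (hp2 i j y hy).add hS (hq2 i j y hy)
    · rw [Polynomial.map_add, map_add, LinearMap.add_apply, hp3, hq3, map_add, add_smul]
  | monomial n a =>
    have hrat_pow : ∀ (k : ℕ) (y : complexBetti S (2 * 1)), IsRationalClass y → IsRationalClass ((f ^ k) y) := by
      intro k
      induction k with
      | zero => intro y hy; simpa only [pow_zero, Module.End.one_apply] using hy
      | succ k ih => intro y hy; rw [pow_succ', Module.End.mul_apply]; exact h1 _ (ih y hy)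
    have htyp_pow : ∀ (k i j : ℕ) (y : complexBetti S (2 * 1)), IsOfHodgeType 2 S (2 * 1) i j y →
        IsOfHodgeType 2 S (2 * 1) i j ((f ^ k) y) := by
      intro k
      induction k with
      | zero => intro i j y hy; simpa only [pow_zero, Module.End.one_apply] using hy
      | succ k ih => intro i j y hy; rw [pow_succ', Module.End.mul_apply]; exact h2 i j _ (ih i j y hy)
    have happ : ∀ y, aeval f ((monomial n a).map (algebraMap ℚ ℂ)) y = (a : ℂ) • (f ^ n) y := by
      intro y
      rw [Polynomial.map_monomial, aeval_monomial, Module.End.mul_apply, Module.algebraMap_end_apply, eq_ratCast]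
    refine ⟨fun y hy => ?_, fun i j y hy => ?_, ?_⟩
    · rw [happ]
      exact (hrat_pow n y hy).smul a
    · rw [happ]
      exact (htyp_pow n i j y hy).smul _
    · rw [happ, pow_apply_of_apply_eq_smul f hσ n, smul_smul, aeval_monomial, eq_ratCast]

/-- A finite `ℚ`-combination of powers of `f` acts on an eigenvector `σ` (`f σ = ev σ`) by the value at `ev` of
the corresponding rational polynomial `∑ aᵢ Xⁱ`. [folklore] -/
theorem sum_ratSmul_pow_apply_eq_aeval_smul (f : complexBetti S (2 * 1) →ₗ[ℂ] complexBetti S (2 * 1))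
    {σ : complexBetti S (2 * 1)} {ev : ℂ} (h : f σ = ev • σ) {n : ℕ} (a : Fin n → ℚ) :
    ∑ i : Fin n, (a i : ℂ) • (f ^ (i : ℕ)) σ =
      (aeval ev (∑ i : Fin n, monomial (i : ℕ) (a i))) • σ := by
  rw [map_sum, Finset.sum_smul]
  refine Finset.sum_congr rfl fun i _ => ?_
  rw [pow_apply_of_apply_eq_smul f h, smul_smul, aeval_monomial, eq_ratCast]

/-! ### §1 The `(2,0)`-class: transcendental, and an endomorphism killing it vanishes on `T(S)` -/

/-- **Marking picture of the `(2,0)`-line** (granted markings): a projective K3 surface carries a non-zero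
`(2,0)`-class `σ` which is cup-orthogonal to `N¹(S)` (Lefschetz: algebraic classes are of type `(1,1)`, and
`H^{1,1} ⊥ σ`) and spans the `(2,0)`-classes. [cite: Huybrechts2016K3, Ch. 3 Lemma 3.3.1 and Ch. 6 Prop. 1.2] -/
theorem exists_twoZero_transc (hmark : Huybrechts_K3_marking_exists) (hS : IsK3Surface S) :
    ∃ σ : complexBetti S (2 * 1), IsOfHodgeType 2 S (2 * 1) 2 0 σ ∧ σ ≠ 0 ∧ Transc[S, σ] ∧
      ∀ τ : complexBetti S (2 * 1), IsOfHodgeType 2 S (2 * 1) 2 0 τ → ∃ c : ℂ, τ = c • σ := by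
  obtain ⟨η, p, x, hp0, ⟨-, -, -, hηcup, hx20, hx20'⟩, -, hxpos, -⟩ := hmark S hS
  have hxne : η.symm x ≠ 0 := by
    intro h0
    have hx : x = 0 := by simpa using congrArg η h0
    subst hx
    simp [k3Form] at hxpos
  obtain ⟨-, -, h₃⟩ := Huybrechts_K3_hodgeTypes_H2_holds S hS (η.symm x) hx20 hxne
  refine ⟨η.symm x, hx20, hxne, fun d hd => ?_, hx20'⟩
  have h11 : IsOfHodgeType 2 S (2 * 1) 1 1 d :=
    isOfHodgeType_of_mem_algebraicClasses_of_isSmoothProjective hS.isSmoothProjective 1 hd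
  have hdσ := ((h₃ d).1 h11).1
  rw [hηcup] at hdσ ⊢
  rwa [k3Form_comm]

/-- An endomorphism with eigenvalue `ev` on SOME non-zero `(2,0)`-class has eigenvalue `ev` on a class `σ`
spanning the `(2,0)`-classes (`h^{2,0}(S) = 1`). [cite: Huybrechts2016K3, Ch. 3 Def. 2.3] -/
theorem apply_eq_smul_of_twoZero {f : complexBetti S (2 * 1) →ₗ[ℂ] complexBetti S (2 * 1)} {ev : ℂ}
    (hf : ∃ (σ₀ : complexBetti S (2 * 1)), IsOfHodgeType 2 S (2 * 1) 2 0 σ₀ ∧ σ₀ ≠ 0 ∧ f σ₀ = ev • σ₀)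
    {σ : complexBetti S (2 * 1)}
    (hline : ∀ τ : complexBetti S (2 * 1), IsOfHodgeType 2 S (2 * 1) 2 0 τ → ∃ c : ℂ, τ = c • σ) :
    f σ = ev • σ := by
  obtain ⟨σ₀, h20, hne, hfσ₀⟩ := hf
  obtain ⟨c, hc⟩ := hline σ₀ h20
  have hc0 : c ≠ 0 := by
    rintro rfl
    rw [zero_smul] at hc
    exact hne hc
  rw [hc, map_smul, smul_comm] at hfσ₀
  exact smul_right_injective _ hc0 hfσ₀

/-- **An endomorphism killing the `2`-form vanishes on `T(S)`.** For a projective K3 surface `S` (granted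
markings) and `f ∈ End H²(S(ℂ); ℂ)` preserving rational classes and Hodge types with `f σ₀ = 0` for a non-zero
`(2,0)`-class `σ₀`: `f y = 0` for every transcendental `y`. Otherwise `exists_annihilating_polynomial` gives
`P ∈ ℚ[X]` with `P(0) ≠ 0` and `P(f) = 0` on `T(S)`; but `σ₀ ∈ T(S)` and `P(f) σ₀ = P(0) σ₀ ≠ 0`. (Zarhin: the
kernel of a Hodge endomorphism of the irreducible `T(S)` containing `σ₀` is everything.)
[cite: Zarhin1983HodgeGroupsK3, Thm. 1.5.1 and Thm. 1.6] [cite: Huybrechts2016K3, Ch. 3 Lemma 3.3.1] -/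
theorem apply_eq_zero_of_transc_of_apply_twoZero_eq_zero (hmark : Huybrechts_K3_marking_exists)
    (hS : IsK3Surface S) (f : complexBetti S (2 * 1) →ₗ[ℂ] complexBetti S (2 * 1))
    (hf_rat : ∀ y, IsRationalClass y → IsRationalClass (f y))
    (hf_typ : ∀ (i j : ℕ) y, IsOfHodgeType 2 S (2 * 1) i j y → IsOfHodgeType 2 S (2 * 1) i j (f y))
    (hfσ : ∃ σ₀ : complexBetti S (2 * 1), IsOfHodgeType 2 S (2 * 1) 2 0 σ₀ ∧ σ₀ ≠ 0 ∧ f σ₀ = 0) :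
    ∀ y : complexBetti S (2 * 1), Transc[S, y] → f y = 0 := by
  classical
  by_contra hcon
  push Not at hcon
  obtain ⟨y, hy, hne⟩ := hcon
  obtain ⟨P, hP0, hP⟩ := exists_annihilating_polynomial hmark hS f hf_rat hf_typ ⟨y, hy, hne⟩
  obtain ⟨σ, -, hσne, hσT, hline⟩ := exists_twoZero_transc hmark hS
  obtain ⟨σ₀, h20, hne0, hf0⟩ := hfσ
  have hfσ0 : f σ = (0 : ℂ) • σ := by
    rw [zero_smul]
    have h := apply_eq_smul_of_twoZero (ev := 0) ⟨σ₀, h20, hne0, by rw [hf0, zero_smul]⟩ hline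
    rwa [zero_smul] at h
  have hPσ := hP σ hσT
  rw [(aeval_ratPoly_apply_surface hS.isSmoothProjective f hf_rat hf_typ hfσ0 P).2.2] at hPσ
  rcases smul_eq_zero.1 hPσ with h0 | h0
  · rw [← Polynomial.coeff_zero_eq_aeval_zero' P, eq_ratCast, Rat.cast_eq_zero] at h0
    exact hP0 h0
  · exact hσne h0

/-- **The `(2,0)`-eigenvalue of a rational, type-preserving endomorphism of `H²(S)` is algebraic over `ℚ`**
(granted markings): if `f ≠ 0` on `T(S)`, the annihilating polynomial `P` (`P(0) ≠ 0`) has `P(ev) σ = P(f) σ = 0`;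
if `f = 0` on `T(S)` then `ev = 0`. [cite: Zarhin1983HodgeGroupsK3, Thm. 1.6] [cite: Huybrechts2016K3, Ch. 3 Cor. 3.3.6] -/
theorem isIntegral_eigenvalue_twoZero (hmark : Huybrechts_K3_marking_exists) (hS : IsK3Surface S)
    (f : complexBetti S (2 * 1) →ₗ[ℂ] complexBetti S (2 * 1))
    (hf_rat : ∀ y, IsRationalClass y → IsRationalClass (f y))
    (hf_typ : ∀ (i j : ℕ) y, IsOfHodgeType 2 S (2 * 1) i j y → IsOfHodgeType 2 S (2 * 1) i j (f y))
    {ev : ℂ} (hf_ev : ∃ σ₀ : complexBetti S (2 * 1), IsOfHodgeType 2 S (2 * 1) 2 0 σ₀ ∧ σ₀ ≠ 0 ∧ f σ₀ = ev • σ₀) :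
    IsIntegral ℚ ev := by
  classical
  obtain ⟨σ, -, hσne, hσT, hline⟩ := exists_twoZero_transc hmark hS
  have hfσ : f σ = ev • σ := apply_eq_smul_of_twoZero hf_ev hline
  by_cases h0 : ∃ y : complexBetti S (2 * 1), Transc[S, y] ∧ f y ≠ 0
  · obtain ⟨P, hP0, hP⟩ := exists_annihilating_polynomial hmark hS f hf_rat hf_typ h0
    have hPσ := hP σ hσT
    rw [(aeval_ratPoly_apply_surface hS.isSmoothProjective f hf_rat hf_typ hfσ P).2.2] at hPσ
    rcases smul_eq_zero.1 hPσ with h1 | h1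
    · have hPne : P ≠ 0 := fun h => hP0 (by rw [h, Polynomial.coeff_zero])
      exact (isAlgebraic_iff_isIntegral.1 ⟨P, hPne, h1⟩)
    · exact absurd h1 hσne
  · push Not at h0
    have h1 : ev • σ = 0 := by rw [← hfσ, h0 σ hσT]
    rcases smul_eq_zero.1 h1 with h2 | h2
    · rw [h2]; exact isIntegral_zero
    · exact absurd h2 hσne

/-! ### §2 «K3-CELL-GEN»: in a known RM type, an endomorphism whose eigenvalue has full degree generates -/

/-- **«K3-CELL-GEN» — in a KNOWN real-multiplication type, ONE endomorphism whose `(2,0)`-eigenvalue has full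
degree generates `End_Hdg(T(S))`.** Let `S` be a projective K3 surface (granted markings), `θ` a rational,
type-preserving endomorphism of `H²(S(ℂ); ℂ)` GENERATING the transcendental Hodge endomorphisms
(`TranscendentalEndomorphismsGeneratedBy S θ`: `End_Hdg(T(S)) = ℚ[θ|_T]`) whose `(2,0)`-eigenvalue has minimal
polynomial of degree `d` (so `[E(S):ℚ] = d`), and `t` a rational, type-preserving endomorphism killing `N¹(S)`
with image cup-orthogonal to `N¹(S)` whose `(2,0)`-eigenvalue ALSO has degree `d`. Then
`TranscendentalEndomorphismsGeneratedBy S t`. No degree law `k·j·m + ρ(S) ≠ 22`, no primality, no CM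
exclusion. [cite: Zarhin1983HodgeGroupsK3, Thm. 1.5.1] [cite: Huybrechts2016K3, Ch. 3 Cor. 3.3.6]
[cite: GeemenSchutt2023, §2.1 and §4.8] -/
theorem transcendentalEndomorphismsGeneratedBy_of_generatedBy_of_natDegree
    (hmark : Huybrechts_K3_marking_exists) (hS : IsK3Surface S)
    (θ : complexBetti S (2 * 1) →ₗ[ℂ] complexBetti S (2 * 1))
    (hθ_rat : ∀ y, IsRationalClass y → IsRationalClass (θ y))
    (hθ_typ : ∀ (i j : ℕ) y, IsOfHodgeType 2 S (2 * 1) i j y → IsOfHodgeType 2 S (2 * 1) i j (θ y))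
    (hθ_gen : TranscendentalEndomorphismsGeneratedBy S θ) {d : ℕ}
    (hθ_ev : ∃ (σ₀ : complexBetti S (2 * 1)) (ev₀ : ℂ), IsOfHodgeType 2 S (2 * 1) 2 0 σ₀ ∧ σ₀ ≠ 0 ∧
      θ σ₀ = ev₀ • σ₀ ∧ (minpoly ℚ ev₀).natDegree = d)
    (t : complexBetti S (2 * 1) →ₗ[ℂ] complexBetti S (2 * 1))
    (ht_rat : ∀ y, IsRationalClass y → IsRationalClass (t y))
    (ht_typ : ∀ (i j : ℕ) y, IsOfHodgeType 2 S (2 * 1) i j y → IsOfHodgeType 2 S (2 * 1) i j (t y))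
    (ht_N : ∀ d ∈ algebraicClasses S 1, t d = 0)
    (ht_perp : ∀ y : complexBetti S (2 * 1), Transc[S, t y])
    (ht_ev : ∃ (σ₁ : complexBetti S (2 * 1)) (ev : ℂ), IsOfHodgeType 2 S (2 * 1) 2 0 σ₁ ∧ σ₁ ≠ 0 ∧
      t σ₁ = ev • σ₁ ∧ (minpoly ℚ ev).natDegree = d) :
    TranscendentalEndomorphismsGeneratedBy S t := by
  classical
  have hS2 : IsSmoothProjective 2 S := hS.isSmoothProjective
  obtain ⟨σ, hσ20, hσne, hσT, hline⟩ := exists_twoZero_transc hmark hS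
  obtain ⟨σ₀, ev₀, h20₀, hne₀, hθσ₀, hdeg₀⟩ := hθ_ev
  obtain ⟨σ₁, ev, h20₁, hne₁, htσ₁, hdeg⟩ := ht_ev
  have hθσ : θ σ = ev₀ • σ := apply_eq_smul_of_twoZero ⟨σ₀, h20₀, hne₀, hθσ₀⟩ hline
  have htσ : t σ = ev • σ := apply_eq_smul_of_twoZero ⟨σ₁, h20₁, hne₁, htσ₁⟩ hline
  -- (1) `t = P(θ)` on `T(S)`, so `ev = P(ev₀)`
  obtain ⟨n, a, ha⟩ := hθ_gen t ht_rat ht_typ ht_N (fun y d hd => ht_perp y d hd)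
  set Pt : ℚ[X] := ∑ i : Fin n, monomial (i : ℕ) (a i) with hPt
  have hev : ev = aeval ev₀ Pt := by
    have h1 := ha σ hσT
    rw [htσ, sum_ratSmul_pow_apply_eq_aeval_smul θ hθσ a] at h1
    exact smul_left_injective ℂ hσne h1
  -- (2) degree count: `ev₀ = Q(ev)`
  have hint : IsIntegral ℚ ev₀ := isIntegral_eigenvalue_twoZero hmark hS θ hθ_rat hθ_typ ⟨σ₀, h20₀, hne₀, hθσ₀⟩
  have hd : 1 ≤ d := by rw [← hdeg₀]; exact minpoly.natDegree_pos hint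
  obtain ⟨Q, hQ⟩ := exists_aeval_eq_of_natDegree_minpoly_eq hev hd hdeg₀ hdeg
  -- (3) `Q(t) − θ` kills `σ`, hence vanishes on `T(S)`: `θ = Q(t)` on `T(S)`
  set Qc : ℂ[X] := Q.map (algebraMap ℚ ℂ) with hQc
  obtain ⟨hQrat, hQtyp, hQσ⟩ := aeval_ratPoly_apply_surface hS2 t ht_rat ht_typ htσ Q
  have hθQ : ∀ y : complexBetti S (2 * 1), Transc[S, y] → θ y = aeval t Qc y := by
    -- `G := Q(t) + (-1)·θ` (written with a RATIONAL scalar) is rational, type-preserving and kills `σ`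
    have h := apply_eq_zero_of_transc_of_apply_twoZero_eq_zero hmark hS (aeval t Qc + ((-1 : ℚ) : ℂ) • θ)
      (fun y hy => by
        rw [LinearMap.add_apply, LinearMap.smul_apply]
        exact (hQrat y hy).add ((hθ_rat y hy).smul (-1)))
      (fun i j y hy => by
        rw [LinearMap.add_apply, LinearMap.smul_apply]
        exact (hQtyp i j y hy).add hS2 ((hθ_typ i j y hy).smul _))
      ⟨σ, hσ20, hσne, by
        rw [LinearMap.add_apply, LinearMap.smul_apply, hQσ, hQ, hθσ, Rat.cast_neg, Rat.cast_one, neg_one_smul,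
          add_neg_cancel]⟩
    intro y hy
    have h1 := h y hy
    rw [LinearMap.add_apply, LinearMap.smul_apply, Rat.cast_neg, Rat.cast_one, neg_one_smul,
      add_neg_eq_zero] at h1
    exact h1.symm
  -- (4) `T(S)` (as a `ℂ`-subspace) is stable under `t`, hence under `Q(t)`
  let T : Submodule ℂ (complexBetti S (2 * 1)) :=
    { carrier := {y | Transc[S, y]}
      add_mem' := fun {a b} ha hb d hd => by
        simp only [Set.mem_setOf_eq] at ha hb
        rw [map_add, LinearMap.add_apply, ha d hd, hb d hd, add_zero]
      zero_mem' := fun d _ => by rw [map_zero, LinearMap.zero_apply]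
      smul_mem' := fun c a ha d hd => by
        simp only [Set.mem_setOf_eq] at ha
        rw [map_smul, LinearMap.smul_apply, ha d hd, smul_zero] }
  have memT : ∀ y, y ∈ T ↔ Transc[S, y] := fun y => Iff.rfl
  have hTt : ∀ y ∈ T, t y ∈ T := fun y _ => (memT _).2 (ht_perp y)
  have hTQ : ∀ y ∈ T, aeval t Qc y ∈ T :=
    fun y hy => (aeval_apply_eq_of_eqOn T t t (fun _ _ => rfl) hTt Qc y hy).2
  -- (5) every admissible `f` is a rational polynomial in `θ`, hence in `t`, on `T(S)`
  intro f hf_rat hf_typ hf_N hf_perp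
  obtain ⟨m, b, hb⟩ := hθ_gen f hf_rat hf_typ hf_N hf_perp
  set R : ℚ[X] := ∑ i : Fin m, C (b i) * Q ^ (i : ℕ) with hR
  obtain ⟨k, c, hc⟩ := exists_fin_sum_eq_aeval_ratPoly t R
  refine ⟨k, c, fun y hy => ?_⟩
  rw [← hc y, hb y hy, hR, Polynomial.map_sum, map_sum, LinearMap.sum_apply]
  refine Finset.sum_congr rfl fun i _ => ?_
  rw [Polynomial.map_mul, Polynomial.map_C, Polynomial.map_pow, map_mul, aeval_C, map_pow, Module.End.mul_apply,
    Module.algebraMap_end_apply, eq_ratCast,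
    (pow_apply_eq_of_eqOn T θ (aeval t Qc) (fun y hy => hθQ y ((memT y).1 hy)) hTQ i y ((memT y).2 hy)).1]

/-- **«K3-CELL-GEN», PRIME DEGREE: any IRRATIONAL `(2,0)`-eigenvalue generates.** As
`transcendentalEndomorphismsGeneratedBy_of_generatedBy_of_natDegree` with `d` prime: an admissible `t` whose
`(2,0)`-eigenvalue is irrational generates `End_Hdg(T(S))` — `ev_t = P(ev_θ)` lies in the prime-degree field
`ℚ(ev_θ)` and is not rational, so it has degree `d` (`natDegree_minpoly_eq_of_prime_of_irrational`).
[cite: Zarhin1983HodgeGroupsK3, Thm. 1.5.1] [cite: GeemenSchutt2023, §2.1 and §4.8] -/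
theorem transcendentalEndomorphismsGeneratedBy_of_generatedBy_of_irrational_of_prime
    (hmark : Huybrechts_K3_marking_exists) (hS : IsK3Surface S)
    (θ : complexBetti S (2 * 1) →ₗ[ℂ] complexBetti S (2 * 1))
    (hθ_rat : ∀ y, IsRationalClass y → IsRationalClass (θ y))
    (hθ_typ : ∀ (i j : ℕ) y, IsOfHodgeType 2 S (2 * 1) i j y → IsOfHodgeType 2 S (2 * 1) i j (θ y))
    (hθ_gen : TranscendentalEndomorphismsGeneratedBy S θ) {d : ℕ} (hp : d.Prime)
    (hθ_ev : ∃ (σ₀ : complexBetti S (2 * 1)) (ev₀ : ℂ), IsOfHodgeType 2 S (2 * 1) 2 0 σ₀ ∧ σ₀ ≠ 0 ∧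
      θ σ₀ = ev₀ • σ₀ ∧ (minpoly ℚ ev₀).natDegree = d)
    (t : complexBetti S (2 * 1) →ₗ[ℂ] complexBetti S (2 * 1))
    (ht_rat : ∀ y, IsRationalClass y → IsRationalClass (t y))
    (ht_typ : ∀ (i j : ℕ) y, IsOfHodgeType 2 S (2 * 1) i j y → IsOfHodgeType 2 S (2 * 1) i j (t y))
    (ht_N : ∀ d ∈ algebraicClasses S 1, t d = 0)
    (ht_perp : ∀ y : complexBetti S (2 * 1), Transc[S, t y])
    (ht_ev : ∃ (σ₁ : complexBetti S (2 * 1)) (ev : ℂ), IsOfHodgeType 2 S (2 * 1) 2 0 σ₁ ∧ σ₁ ≠ 0 ∧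
      t σ₁ = ev • σ₁ ∧ ∀ a : ℚ, (a : ℂ) ≠ ev) :
    TranscendentalEndomorphismsGeneratedBy S t := by
  classical
  obtain ⟨σ, -, hσne, hσT, hline⟩ := exists_twoZero_transc hmark hS
  obtain ⟨σ₀, ev₀, h20₀, hne₀, hθσ₀, hdeg₀⟩ := hθ_ev
  obtain ⟨σ₁, ev, h20₁, hne₁, htσ₁, hirr⟩ := ht_ev
  have hθσ : θ σ = ev₀ • σ := apply_eq_smul_of_twoZero ⟨σ₀, h20₀, hne₀, hθσ₀⟩ hline
  have htσ : t σ = ev • σ := apply_eq_smul_of_twoZero ⟨σ₁, h20₁, hne₁, htσ₁⟩ hline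
  obtain ⟨n, a, ha⟩ := hθ_gen t ht_rat ht_typ ht_N (fun y d hd => ht_perp y d hd)
  have hev : ev = aeval ev₀ (∑ i : Fin n, monomial (i : ℕ) (a i)) := by
    have h1 := ha σ hσT
    rw [htσ, sum_ratSmul_pow_apply_eq_aeval_smul θ hθσ a] at h1
    exact smul_left_injective ℂ hσne h1
  have hdeg : (minpoly ℚ ev).natDegree = d := natDegree_minpoly_eq_of_prime_of_irrational hev hp hdeg₀ hirr
  exact transcendentalEndomorphismsGeneratedBy_of_generatedBy_of_natDegree hmark hS θ hθ_rat hθ_typ hθ_gen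
    ⟨σ₀, ev₀, h20₀, hne₀, hθσ₀, hdeg₀⟩ t ht_rat ht_typ ht_N ht_perp ⟨σ₁, ev, h20₁, hne₁, htσ₁, hdeg⟩

end Summit.HodgeConjecture.HodgeConjecture.Theorems.MarkmanPartnerTransport.OneCycle

end
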